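import Literature.MathematicalPhysics.QuantumFieldTheory.Balaban1983to89.B2Eq265CentredBox

/-!
# `Balaban1983to89.B2Eq265Restrictions255` — [Balaban1982Higgs2] Lemma 2.4 (2.65) p.572 on the (Higgs)₂,₃ carrier of record with the
# hypotheses on `φ` taken BY NAME from the restrictions (2.55) p.570 (the typer's predicate `B2Eq255Concrete.Restr255`): Lemma 2.4's own
# hypothesis «Under the restrictions (2.55) we have …» and its proof's sentence p.573 (AS PRINTED, render re-read by the row owner r02
# 2026-08-23) «Now let us consider the restrictions (2.55) on the field φ. The estimates of the covariant derivatives give us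
# |U(A₀(⟨y′, y″⟩))φ(y″) − φ(y′)| ≦ O(1)p(Lᵏε).» — so the sizes `t′` ((2.55)₄) and `λ_A` ((2.55)₃) of F6–F8 are no longer binders
# (`eq265_higgs_region_restr255`)

statement-level skeleton of published theorems with citation tags; proofs where landed; nothing here is a claim
about the Yang–Mills mass gap

PDF held: `paper:balaban1982-cmp86-higgs23-ii` (journal page = PDF page + 554), p. 570 [PDF 16] ((2.55), text layer p0016 L2–5), p. 572
[PDF 18] (Lemma 2.4, L1–4), p. 573 [PDF 19] (L18–20).

CITATION HEADER (lean-in-tree rule).  T. Bałaban, *(Higgs)₂,₃ quantum fields in a finite volume. II. An upper bound*,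
Commun. Math. Phys. **86** (1982) 555–594, doi:10.1007/bf01214890 [Balaban1982Higgs2].  Cell `lit-balaban` (HOME
`run/shared/lean/pub/lit-balaban/`), Phase-2 proof seat **p23** gen 22 (unit `lit-balaban-p23-g22`; free-target protocol G.5-34(d), TAKING #1
line HOME/STATUS.md 2026-08-23T06:04Z); SKELETON row **B2.Lem2.4** (fold owner r02, second reader r14; head `proved p250408 · …` UNCHANGED —
cells-only member, brick F9; the «by-name bridge from `Restr255`'s third conjunct» named by the owner r02 g48).  USED BY NAME, never restated:
own F8 `B2Eq265CentredBox.eq265_higgs_region_centred`, the typer's `B2Eq255Concrete.{Restr255, dPhi, absPhi, barA, bgScalar256, underRegion}`,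
`HiggsLattice.covDeriv` ((I.1.7)).

THE ARGUMENT.  (2.55) p.570 reads, for `x ∈ Λ₋₁^{(k−1)′}`, `b ⊂ Λ₋₁^{(k−1)′}`: «|(D_{Ā^{(k)}}φ)(b)| ≦ c₁p(L^{k−1}ε)» and «|φ(x)| ≦
(c₁/λ(L^{k−1}ε)^{1/4})p(L^{k−1}ε)»; the typer's `Restr255 C c₁ pℓ tA tPhi k Λ A′ φ A^{(k)}` carries them as its conjuncts 3–4 with general
thresholds (`dPhi C k A^{(k)} φ b = ‖(D_{Ā^{(k)}}φ)(b)‖ ≤ c₁pℓ` on the bonds inside `Λ`, `absPhi φ x = ‖φ(x)‖ ≤ c₁·tPhi·pℓ` on `Λ`).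
Since `(D^η_Bφ)(b) = η⁻¹(U_η(B_b)φ(b₊) − φ(b₋))` ((I.1.7), `η = Lᵏε` on `T^{(k)}`), the covariant per-bond hypothesis of F6–F8
`‖U_{Lᵏε}(Ā^{(k)}_b)φ(b₊) − φ(b₋)‖ ≤ λ_A` on the bonds of `□₁ ⊆ Λ₆ ⊆ Λ₋₁` holds with `λ_A := (Lᵏε)·c₁pℓ` (`norm_transport_sub_eq`), and
`|φ| ≤ t′` on `Λ₆` with `t′ := c₁·tPhi·pℓ`; feeding both to F8 gives (2.65) under (2.55) itself.

WHAT THIS FILE PROVES (kernel-checked, zero `sorry`; theorems only — NO definition, NO `Prop`-valued fact; axioms standard).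
 §1 `norm_transport_sub_eq` (`‖U_η(B_b)φ(b₊) − φ(b₋)‖ = η·‖(D^η_Bφ)(b)‖`), `norm_transport_sub_le_of_restr255`, `norm_le_of_restr255`
    (the two φ-bounds of F8 READ OFF `Restr255`).
 §2 **`eq265_higgs_region_restr255`** — (2.65) value clause on the carrier: F8's statement word for word except (located edits) the two
    φ-hypotheses `0 ≤ t′`, `∀ y ∈ Λ₆, ‖φ y‖ ≤ t′`, `0 ≤ λ_A`, `‖U_ℓ(Ā^{(k)}_{⟨y,μ⟩})φ(y+e_μ) − φ(y)‖ ≤ λ_A on □₁` REPLACED by the binders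
    `Λ₋₁ ⊇ Λ₆`, `A′`, `c₁, pℓ, tPhi ≥ 0`, `tA` and ONE hypothesis `Restr255 C c₁ pℓ tA tPhi k Λ₋₁ A′ φ A`, with `t′ ↦ c₁·tPhi·pℓ` and
    `λ_A ↦ (Lᵏε)·(c₁·pℓ)` at every occurrence of the bound; `eq265_higgs_region_restr255Printed` — the same under the typer's
    `Restr255Printed` (the printed thresholds `p(ℓ) = b₀(1 + log ℓ⁻¹)^p`, `1/(μ₀ℓ)`, `1/λ(ℓ)^{1/4}`, `ℓ ↤ L^{k−1}ε` a free letter).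

HONEST SCOPE / DIFFERENCES FROM PRINT (recorded, not hidden; one sentence each).  (a) THRESHOLDS: `Restr255` carries GENERAL nonnegative
thresholds `c₁, pℓ, tA, tPhi` (the typer's dictionary `pℓ ↤ p(L^{k−1}ε)`, `tA ↤ 1/(μ₀L^{k−1}ε)`, `tPhi ↤ 1/λ(L^{k−1}ε)^{1/4}`;
`Restr255Printed` is the printed instance) — the statement is homogeneous in them, nothing is evaluated.  (b) REGION: print's (2.55) lives on
`Λ₋₁^{(k−1)′} ⊇ Λ₆^{(k−1)′} ⊇ □₁`; here `Λ₋₁` is any coarse region containing `Λ₆` (and hence `□₁ ⊆ Λ₆`), the chain of print's regions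
(2.8) being the user's.  (c) CONJUNCTS 1–2 of (2.55) (on the vector field `A′` of the step) are NOT used here: they enter Lemma 2.4 only
through `A^{(k)}` = the minimizer (2.54) of `A′`, i.e. through (2.60) = row B2.Lem2.3 — the `δA` hypothesis, kept (brick F10 feeds it by
name from r14's `B2Lemma23HiggsLattice`).  (d) Everything else as in F8's HONEST SCOPE (value clause only; `□₁` a centred cube of coarse
sites, `R₁ ⇐ 2r(Lᵏε)`, `S ⇐ 4r(Lᵏε)`, the depth of `x`, base point the corner, `δA ⇐` (2.60) not derived here, constants' provenance).
NOT summit progress.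
-/

open scoped BigOperators

noncomputable section

namespace Literature.MathematicalPhysics.QuantumFieldTheory.Balaban1983to89.B2Eq265Restrictions255

open HiggsLattice (ChargeData covDeriv)
open HiggsAveraging (blockIter)
open HiggsCovariance (avgQkAdj)
open HiggsCovariancePos (Inside)
open B2Eq255Concrete (bgScalar256 underRegion barA Restr255 Restr255Printed dPhi absPhi dPhi_eq)
open B2Eq265CentredBox (eq265_higgs_region_centred)
open B1Ineq225RegularBox (cellBox)
open B1Ineq234Concrete (distC)
open B1TorusRegionHSizes (IsBigBlockUnion)
open B1TorusCubeCover (half)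
open B1TorusCubeLocality26 (rS)

variable {P : HiggsLattice.Params} {N : ℕ} {k : ℕ}

/-! ## §1 The two `φ`-bounds read off (2.55) -/

section Readings

/-- **(I.1.7) unfolded under the norm**: `‖U_η(B_b)φ(b₊) − φ(b₋)‖ = η·‖(D^η_Bφ)(b)‖`, `η = Lᵏε` the mesh of `T^{(k)}`.
[cite: Balaban1982Higgs1, (1.7) p.605] -/
theorem norm_transport_sub_eq (C : ChargeData N) (B : HiggsLattice.VecField P k) (φ : HiggsLattice.ScalarField P k N)
    (b : HiggsLattice.PBond P k) :
    ‖C.U (P.mesh k) (B b) (φ b.tgt) - φ b.src‖ = P.mesh k * ‖covDeriv C B φ b‖ := by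
  have hm : 0 < P.mesh k := P.mesh_pos k
  unfold covDeriv
  rw [norm_smul, Real.norm_eq_abs, abs_of_pos (inv_pos.mpr hm), ← mul_assoc, mul_inv_cancel₀ hm.ne', one_mul]

/-- **(2.55)₃ gives the covariant per-bond bound of F6–F8**: under `Restr255 C c₁ pℓ tA tPhi k Λ A′ φ A`, every bond `⟨y, y+e_μ⟩` with both
endpoints in `Λ` has `‖U_{Lᵏε}(Ā^{(k)}_{⟨y,μ⟩})φ(y+e_μ) − φ(y)‖ ≤ (Lᵏε)·(c₁pℓ)` — print p.573: «The estimates of the covariant derivatives give us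
|U(A₀(⟨y′, y″⟩))φ(y″) − φ(y′)| ≦ O(1)p(Lᵏε).» [cite: Balaban1982Higgs2, (2.55) p.570]
[cite: Balaban1982Higgs2, Lemma 2.4 proof p.573 «Now let us consider the restrictions (2.55) on the field φ. The estimates of the covariant derivatives give us |U(A₀(⟨y′, y″⟩))φ(y″) − φ(y′)| ≦ O(1)p(Lᵏε).»] -/
theorem norm_transport_sub_le_of_restr255 {C : ChargeData N} {c₁ pℓ tA tPhi : ℝ} {Λ : Finset (HiggsLattice.Site P k)}
    {A' : HiggsLattice.VecField P k} {φ : HiggsLattice.ScalarField P k N} {A : HiggsLattice.VecField P 0}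
    (h : Restr255 C c₁ pℓ tA tPhi k Λ A' φ A) {y : HiggsLattice.Site P k} {μ : Fin P.d} (hy : y ∈ Λ) (hyμ : y.shift μ ∈ Λ) :
    ‖C.U (P.mesh k) (barA k A ⟨y, μ⟩) (φ (y.shift μ)) - φ y‖ ≤ P.mesh k * (c₁ * pℓ) := by
  have hb : Inside Λ (⟨y, μ⟩ : HiggsLattice.PBond P k) := ⟨hy, hyμ⟩
  have h3 : dPhi C k A φ ⟨y, μ⟩ ≤ c₁ * pℓ := h.2.2.1 _ hb
  rw [dPhi_eq] at h3
  have e := norm_transport_sub_eq C (barA k A) φ (⟨y, μ⟩ : HiggsLattice.PBond P k)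
  simp only [HiggsLattice.PBond.tgt] at e
  rw [e]
  exact mul_le_mul_of_nonneg_left h3 (P.mesh_pos k).le

/-- **(2.55)₄ gives the sup bound of F5–F8**: under `Restr255 C c₁ pℓ tA tPhi k Λ A′ φ A`, `‖φ(y)‖ ≤ c₁·tPhi·pℓ` on every `Λ₆ ⊆ Λ` — print
p.570: «|φ(x)| ≦ (c₁/λ(L^{k−1}ε)^{1/4})p(L^{k−1}ε) for x ∈ Λ₋₁^{(k−1)′}». [cite: Balaban1982Higgs2, (2.55) p.570] -/
theorem norm_le_of_restr255 {C : ChargeData N} {c₁ pℓ tA tPhi : ℝ} {Λ Λ₆ : Finset (HiggsLattice.Site P k)}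
    {A' : HiggsLattice.VecField P k} {φ : HiggsLattice.ScalarField P k N} {A : HiggsLattice.VecField P 0}
    (h : Restr255 C c₁ pℓ tA tPhi k Λ A' φ A) (h6 : Λ₆ ⊆ Λ) : ∀ y ∈ Λ₆, ‖φ y‖ ≤ c₁ * tPhi * pℓ :=
  fun y hy => h.2.2.2 y (h6 hy)

end Readings

/-! ## §2 (2.65) under the restrictions (2.55) -/

section Eq265Restr

/-- **LEMMA 2.4 (2.65), VALUE CLAUSE, ON THE (Higgs)₂,₃ CARRIER — «Under the restrictions (2.55)».**  TYPED vs PRINTED: this is F8's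
`B2Eq265CentredBox.eq265_higgs_region_centred` word for word except the located edits: the four `φ`-items `0 ≤ t′`,
`∀ y ∈ Λ₆, ‖φ y‖ ≤ t′`, `0 ≤ λ_A`, `∀ y μ, y ∈ □₁ → y+e_μ ∈ □₁ → ‖U_{Lᵏε}(Ā^{(k)}_{⟨y,μ⟩})φ(y+e_μ) − φ(y)‖ ≤ λ_A` are REPLACED by the
binders `Λ₋₁` (a coarse region), `A′` (the vector field of the step), `c₁ pℓ tA tPhi` with `0 ≤ c₁`, `0 ≤ pℓ`, `0 ≤ tPhi`, the inclusion
`Λ₆ ⊆ Λ₋₁`, and ONE hypothesis `Restr255 C c₁ pℓ tA tPhi k Λ₋₁ A′ φ A` (= (2.55) on `Λ₋₁` for the fields `A′, φ` and the background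
`A = A^{(k)}`); in the bound `t′ ↦ c₁·tPhi·pℓ` and `λ_A ↦ (Lᵏε)·(c₁·pℓ)` at every occurrence (`norm_le_of_restr255`,
`norm_transport_sub_le_of_restr255`; `□₁ ⊆ Λ₆ ⊆ Λ₋₁`). [cite: Balaban1982Higgs2, Lemma 2.4 (2.65) p.572]
[cite: Balaban1982Higgs2, (2.55) p.570] -/
theorem eq265_higgs_region_restr255 (d L : ℕ) (hd : 1 ≤ d) (hL : 2 ≤ L) {a : ℝ} (ha : 0 < a) {msq : ℝ} (hmsq : 0 < msq)
    (N : ℕ) (C : ChargeData N) (ε₀ : ℝ) (creg β : ℝ) (hcreg : 0 ≤ creg) (hβ : 0 < β) :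
    ∃ K₀min : ℕ, ∀ K₀ : ℕ, K₀min ≤ K₀ → ∃ e₁ t : ℝ, 0 < e₁ ∧ 0 < t ∧
      ∃ C₁ C₂ C₃ D₁ D₂ D₃ D₄ : ℝ, 0 ≤ C₁ ∧ 0 ≤ C₂ ∧ 0 ≤ C₃ ∧ 0 ≤ D₁ ∧ 0 ≤ D₂ ∧ 0 ≤ D₃ ∧ 0 ≤ D₄ ∧
      ∀ (P : HiggsLattice.Params), P.d = d → P.L = L → K₀ ∣ P.M →
      ∀ {k : ℕ}, 1 ≤ k → k ≤ P.K → (∀ μ, 3 * half P k K₀ ≤ P.sitesPerDir 0 μ) → P.mesh k ≤ ε₀ → P.mesh k ≤ 1 →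
      ∀ (Λ₂ Λ₆ sq₂ sq₁ : Finset (HiggsLattice.Site P k)) (S : Fin P.d → Finset ℕ) (q : HiggsLattice.Site P k) (Sbox : ℕ),
        Λ₆ ⊆ Λ₂ → sq₂ ⊆ Λ₂ → sq₁ ⊆ sq₂ → sq₁ ⊆ Λ₆ →
        IsBigBlockUnion k K₀ (underRegion k Λ₂) → underRegion k sq₂ = cellBox k K₀ S →
        (∀ μ : Fin P.d, P.L ^ k * Sbox < P.sitesPerDir 0 μ) →
      -- `□₂` IS the box `q + [0,S)ᵈ` of coarse sites, `□ = B^k(□₂)` smaller than half the torus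
        (∀ y : HiggsLattice.Site P k, y ∈ sq₂ ↔ ∀ ν : Fin P.d, (y ν - q ν).val < Sbox) →
        (∀ μ : Fin P.d, 2 * (P.L ^ k * Sbox) ≤ P.sitesPerDir 0 μ) →
      -- `□₁` is the box of coarse sites of radius `R₁` about `ȳ` (corner `q₁`), smaller than half the torus
      ∀ (q₁ : HiggsLattice.Site P k) (R₁ : ℕ), (∀ μ : Fin P.d, 2 * (2 * R₁ + 1) ≤ P.sitesPerDir k μ) →
        (∀ y : HiggsLattice.Site P k, y ∈ sq₁ ↔ ∀ ν : Fin P.d, (y ν - q₁ ν).val < 2 * R₁ + 1) →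
      -- ONE regularity hypothesis: the small-gradient form on `B^k(Λ₂)`, small in the two printed scalings
      ∀ (A : HiggsLattice.VecField P 0) {δA : ℝ}, 0 ≤ δA →
          (∀ z ∈ underRegion k Λ₂, ∀ μ ν : Fin P.d, |A ⟨z.shift ν, μ⟩ - A ⟨z, μ⟩| ≤ δA) →
          (P.L : ℝ) ^ k * δA * |C.e| ≤ t →
        ∀ {ec : ℝ}, 0 < ec → ec ≤ e₁ → (P.L : ℝ) ^ k * P.mesh k * |C.e| * δA ≤ creg * ec ^ β →
      ∀ (x : HiggsLattice.Site P 0),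
        (∀ z, HiggsLattice.Site.tdist x z ≤ 2 * rS P k K₀ + 2 * half P k K₀ * (P.d + 1) + 1 → z ∈ underRegion k sq₂) →
        (∀ ν : Fin P.d, ((blockIter k x) ν - q₁ ν).val = R₁) →
      -- the restrictions (2.55) on a coarse region `Λ₋₁ ⊇ Λ₆` for the fields `A′, φ` of the step and the background `A^{(k)} = A`
      ∀ (φ : HiggsLattice.ScalarField P k N) (Λm1 : Finset (HiggsLattice.Site P k)) (A' : HiggsLattice.VecField P k)
        {c₁ pℓ tA tPhi : ℝ}, 0 ≤ c₁ → 0 ≤ pℓ → 0 ≤ tPhi → Λ₆ ⊆ Λm1 →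
        Restr255 C c₁ pℓ tA tPhi k Λm1 A' φ A →
        ‖bgScalar256 C msq a k Λ₂ Λ₆ A φ x - avgQkAdj C A k φ x‖
          ≤ B1.aSeq a P.L k * (c₁ * tPhi * pℓ) *
                (C₁ * Real.exp (-(1 / (4 * K₀) * (distC (underRegion k sq₂) x / (P.L : ℝ) ^ k)))
                  + C₂ * Real.exp (-(1 / (4 * K₀) * ((R₁ : ℝ) + 1))))
            + (D₁ * P.mesh k ^ 2 *
                (B1.aSeq a P.L k * (P.mesh k)⁻¹ ^ 2 * (|C.e| * (δA * (P.d * ((P.L : ℝ) ^ k * Sbox))) * P.mesh 0 * (P.d * ((P.L : ℝ) ^ k - 1))) * (c₁ * tPhi * pℓ)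
                  + |C.e| * (δA * (P.d * ((P.L : ℝ) ^ k * Sbox))) * (P.d * ((B1.aSeq a P.L k * (P.mesh k)⁻¹ ^ 2 * (c₁ * tPhi * pℓ) * D₄ * P.mesh k
                        + |C.e| * (δA * (P.d * ((P.L : ℝ) ^ k * Sbox))) * (B1.aSeq a P.L k * D₃ * (c₁ * tPhi * pℓ))) + |C.e| * (δA * (P.d * ((P.L : ℝ) ^ k * Sbox))) * (B1.aSeq a P.L k * D₃ * (c₁ * tPhi * pℓ))))
                  + B1.aSeq a P.L k * (P.mesh k)⁻¹ ^ 2 *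
                      ((2 * (|C.e| * (δA * (P.d * ((P.L : ℝ) ^ k * Sbox))) * P.mesh 0 * (P.d * ((P.L : ℝ) ^ k - 1)))
                        + (|C.e| * (δA * (P.d * ((P.L : ℝ) ^ k * Sbox))) * P.mesh 0 * (P.d * ((P.L : ℝ) ^ k - 1))) ^ 2) * (B1.aSeq a P.L k * D₃ * (c₁ * tPhi * pℓ))))
              + D₂ * P.mesh k * (|C.e| * (δA * (P.d * ((P.L : ℝ) ^ k * Sbox))) * (B1.aSeq a P.L k * D₃ * (c₁ * tPhi * pℓ))))
            + B1.aSeq a P.L k * C₃ *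
                (4 * K₀ * ((P.mesh k * (c₁ * pℓ) + P.mesh k * |C.e| * (δA * (P.d * ((P.L : ℝ) ^ k * Sbox))) * (c₁ * tPhi * pℓ)) * P.d)
                  + Real.exp (-(1 / (4 * K₀) * ((R₁ : ℝ) + 1))) * (c₁ * tPhi * pℓ))
            + msq * P.mesh k ^ 2 / (B1.aSeq a P.L k + msq * P.mesh k ^ 2) * (c₁ * tPhi * pℓ)
            + |C.e| * P.mesh 0 * (P.d * ((P.L : ℝ) ^ k - 1)) * (δA * (P.d * ((P.L : ℝ) ^ k * Sbox))) * (c₁ * tPhi * pℓ) := by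
  obtain ⟨K₀min, h⟩ := eq265_higgs_region_centred d L hd hL ha hmsq N C ε₀ creg β hcreg hβ
  refine ⟨K₀min, fun K₀ hK₀ => ?_⟩
  obtain ⟨e₁, t, he₁, ht, C₁, C₂, C₃, D₁, D₂, D₃, D₄, hC₁, hC₂, hC₃, hD₁, hD₂, hD₃, hD₄, h⟩ := h K₀ hK₀
  refine ⟨e₁, t, he₁, ht, C₁, C₂, C₃, D₁, D₂, D₃, D₄, hC₁, hC₂, hC₃, hD₁, hD₂, hD₃, hD₄, ?_⟩
  intro P hPd hPL hK₀M k hk1 hkK h3 hε h1 Λ₂ Λ₆ sq₂ sq₁ S q Sbox h62 hs2 h12 h16 hΩΛ hbox hSbox hsq₂ h2S q₁ R₁ hS₁ hsq₁ A δA hδA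
    hgrad ht' ec hec hle hsmall x hx hcentre φ Λm1 A' c₁ pℓ tA tPhi hc₁ hpℓ htPhi h6m1 h255
  -- the two `φ`-bounds READ OFF (2.55)
  have ht0 : 0 ≤ c₁ * tPhi * pℓ := mul_nonneg (mul_nonneg hc₁ htPhi) hpℓ
  have hφ : ∀ y ∈ Λ₆, ‖φ y‖ ≤ c₁ * tPhi * pℓ := norm_le_of_restr255 h255 h6m1
  have hlamA : 0 ≤ P.mesh k * (c₁ * pℓ) := mul_nonneg (P.mesh_pos k).le (mul_nonneg hc₁ hpℓ)
  have hcovA : ∀ (y : HiggsLattice.Site P k) (μ : Fin P.d), y ∈ sq₁ → y.shift μ ∈ sq₁ →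
      ‖C.U (P.mesh k) (barA k A ⟨y, μ⟩) (φ (y.shift μ)) - φ y‖ ≤ P.mesh k * (c₁ * pℓ) :=
    fun y μ hy hyμ => norm_transport_sub_le_of_restr255 h255 (h6m1 (h16 hy)) (h6m1 (h16 hyμ))
  exact h P hPd hPL hK₀M hk1 hkK h3 hε h1 Λ₂ Λ₆ sq₂ sq₁ S q Sbox h62 hs2 h12 h16 hΩΛ hbox hSbox hsq₂ h2S q₁ R₁ hS₁ hsq₁ A hδA hgrad
    ht' hec hle hsmall x hx hcentre φ ht0 hφ hlamA hcovA

/-- **(2.65) UNDER (2.55) WITH THE PRINTED THRESHOLDS** p.570 «|(∂A)(b)| ≦ c₁p(L^{k−1}ε), |A(x)| ≦ (c₁/(μ₀L^{k−1}ε))p(L^{k−1}ε),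
|(D_{Ā^{(k)}}φ)(b)| ≦ c₁p(L^{k−1}ε), |φ(x)| ≦ (c₁/λ(L^{k−1}ε)^{1/4})p(L^{k−1}ε) for x ∈ Λ₋₁^{(k−1)′}, b ⊂ Λ₋₁^{(k−1)′}»: the previous theorem
with the typer's `Restr255Printed C c₁ b₀ p μ₀ λ ℓ` (`p(ℓ) = b₀(1 + log ℓ⁻¹)^p` = `B2.pFn` (2.2), `λ(ℓ) = λℓ^{4−d}` = `B2LargeField.lambdaEps`
(2.5); the letter `ℓ ↤ L^{k−1}ε` stays free with `0 < ℓ ≤ 1`, `b₀ ≥ 0`, `λ > 0` for the signs), i.e. `pℓ ↦ p(ℓ)` and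
`tPhi ↦ 1/λ(ℓ)^{1/4}` at every occurrence. [cite: Balaban1982Higgs2, Lemma 2.4 (2.65) p.572] [cite: Balaban1982Higgs2, (2.55) p.570] -/
theorem eq265_higgs_region_restr255Printed (d L : ℕ) (hd : 1 ≤ d) (hL : 2 ≤ L) {a : ℝ} (ha : 0 < a) {msq : ℝ} (hmsq : 0 < msq)
    (N : ℕ) (C : ChargeData N) (ε₀ : ℝ) (creg β : ℝ) (hcreg : 0 ≤ creg) (hβ : 0 < β) :
    ∃ K₀min : ℕ, ∀ K₀ : ℕ, K₀min ≤ K₀ → ∃ e₁ t : ℝ, 0 < e₁ ∧ 0 < t ∧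
      ∃ C₁ C₂ C₃ D₁ D₂ D₃ D₄ : ℝ, 0 ≤ C₁ ∧ 0 ≤ C₂ ∧ 0 ≤ C₃ ∧ 0 ≤ D₁ ∧ 0 ≤ D₂ ∧ 0 ≤ D₃ ∧ 0 ≤ D₄ ∧
      ∀ (P : HiggsLattice.Params), P.d = d → P.L = L → K₀ ∣ P.M →
      ∀ {k : ℕ}, 1 ≤ k → k ≤ P.K → (∀ μ, 3 * half P k K₀ ≤ P.sitesPerDir 0 μ) → P.mesh k ≤ ε₀ → P.mesh k ≤ 1 →
      ∀ (Λ₂ Λ₆ sq₂ sq₁ : Finset (HiggsLattice.Site P k)) (S : Fin P.d → Finset ℕ) (q : HiggsLattice.Site P k) (Sbox : ℕ),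
        Λ₆ ⊆ Λ₂ → sq₂ ⊆ Λ₂ → sq₁ ⊆ sq₂ → sq₁ ⊆ Λ₆ →
        IsBigBlockUnion k K₀ (underRegion k Λ₂) → underRegion k sq₂ = cellBox k K₀ S →
        (∀ μ : Fin P.d, P.L ^ k * Sbox < P.sitesPerDir 0 μ) →
      -- `□₂` IS the box `q + [0,S)ᵈ` of coarse sites, `□ = B^k(□₂)` smaller than half the torus
        (∀ y : HiggsLattice.Site P k, y ∈ sq₂ ↔ ∀ ν : Fin P.d, (y ν - q ν).val < Sbox) →
        (∀ μ : Fin P.d, 2 * (P.L ^ k * Sbox) ≤ P.sitesPerDir 0 μ) →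
      -- `□₁` is the box of coarse sites of radius `R₁` about `ȳ` (corner `q₁`), smaller than half the torus
      ∀ (q₁ : HiggsLattice.Site P k) (R₁ : ℕ), (∀ μ : Fin P.d, 2 * (2 * R₁ + 1) ≤ P.sitesPerDir k μ) →
        (∀ y : HiggsLattice.Site P k, y ∈ sq₁ ↔ ∀ ν : Fin P.d, (y ν - q₁ ν).val < 2 * R₁ + 1) →
      -- ONE regularity hypothesis: the small-gradient form on `B^k(Λ₂)`, small in the two printed scalings
      ∀ (A : HiggsLattice.VecField P 0) {δA : ℝ}, 0 ≤ δA →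
          (∀ z ∈ underRegion k Λ₂, ∀ μ ν : Fin P.d, |A ⟨z.shift ν, μ⟩ - A ⟨z, μ⟩| ≤ δA) →
          (P.L : ℝ) ^ k * δA * |C.e| ≤ t →
        ∀ {ec : ℝ}, 0 < ec → ec ≤ e₁ → (P.L : ℝ) ^ k * P.mesh k * |C.e| * δA ≤ creg * ec ^ β →
      ∀ (x : HiggsLattice.Site P 0),
        (∀ z, HiggsLattice.Site.tdist x z ≤ 2 * rS P k K₀ + 2 * half P k K₀ * (P.d + 1) + 1 → z ∈ underRegion k sq₂) →
        (∀ ν : Fin P.d, ((blockIter k x) ν - q₁ ν).val = R₁) →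
      -- the restrictions (2.55) WITH THE PRINTED THRESHOLDS on a coarse region `Λ₋₁ ⊇ Λ₆` (`ℓ ↤ L^{k−1}ε`)
      ∀ (φ : HiggsLattice.ScalarField P k N) (Λm1 : Finset (HiggsLattice.Site P k)) (A' : HiggsLattice.VecField P k)
        {c₁ b₀ p μ₀ lam ℓ : ℝ}, 0 ≤ c₁ → 0 ≤ b₀ → 0 < lam → 0 < ℓ → ℓ ≤ 1 → Λ₆ ⊆ Λm1 →
        Restr255Printed C c₁ b₀ p μ₀ lam ℓ k Λm1 A' φ A →
        ‖bgScalar256 C msq a k Λ₂ Λ₆ A φ x - avgQkAdj C A k φ x‖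
          ≤ B1.aSeq a P.L k * (c₁ * (1 / (B2LargeField.lambdaEps lam ℓ P.d) ^ (1 / 4 : ℝ)) * B2.pFn b₀ p ℓ) *
                (C₁ * Real.exp (-(1 / (4 * K₀) * (distC (underRegion k sq₂) x / (P.L : ℝ) ^ k)))
                  + C₂ * Real.exp (-(1 / (4 * K₀) * ((R₁ : ℝ) + 1))))
            + (D₁ * P.mesh k ^ 2 *
                (B1.aSeq a P.L k * (P.mesh k)⁻¹ ^ 2 * (|C.e| * (δA * (P.d * ((P.L : ℝ) ^ k * Sbox))) * P.mesh 0 * (P.d * ((P.L : ℝ) ^ k - 1))) * (c₁ * (1 / (B2LargeField.lambdaEps lam ℓ P.d) ^ (1 / 4 : ℝ)) * B2.pFn b₀ p ℓ)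
                  + |C.e| * (δA * (P.d * ((P.L : ℝ) ^ k * Sbox))) * (P.d * ((B1.aSeq a P.L k * (P.mesh k)⁻¹ ^ 2 * (c₁ * (1 / (B2LargeField.lambdaEps lam ℓ P.d) ^ (1 / 4 : ℝ)) * B2.pFn b₀ p ℓ) * D₄ * P.mesh k
                        + |C.e| * (δA * (P.d * ((P.L : ℝ) ^ k * Sbox))) * (B1.aSeq a P.L k * D₃ * (c₁ * (1 / (B2LargeField.lambdaEps lam ℓ P.d) ^ (1 / 4 : ℝ)) * B2.pFn b₀ p ℓ))) + |C.e| * (δA * (P.d * ((P.L : ℝ) ^ k * Sbox))) * (B1.aSeq a P.L k * D₃ * (c₁ * (1 / (B2LargeField.lambdaEps lam ℓ P.d) ^ (1 / 4 : ℝ)) * B2.pFn b₀ p ℓ))))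
                  + B1.aSeq a P.L k * (P.mesh k)⁻¹ ^ 2 *
                      ((2 * (|C.e| * (δA * (P.d * ((P.L : ℝ) ^ k * Sbox))) * P.mesh 0 * (P.d * ((P.L : ℝ) ^ k - 1)))
                        + (|C.e| * (δA * (P.d * ((P.L : ℝ) ^ k * Sbox))) * P.mesh 0 * (P.d * ((P.L : ℝ) ^ k - 1))) ^ 2) * (B1.aSeq a P.L k * D₃ * (c₁ * (1 / (B2LargeField.lambdaEps lam ℓ P.d) ^ (1 / 4 : ℝ)) * B2.pFn b₀ p ℓ))))
              + D₂ * P.mesh k * (|C.e| * (δA * (P.d * ((P.L : ℝ) ^ k * Sbox))) * (B1.aSeq a P.L k * D₃ * (c₁ * (1 / (B2LargeField.lambdaEps lam ℓ P.d) ^ (1 / 4 : ℝ)) * B2.pFn b₀ p ℓ))))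
            + B1.aSeq a P.L k * C₃ *
                (4 * K₀ * ((P.mesh k * (c₁ * B2.pFn b₀ p ℓ) + P.mesh k * |C.e| * (δA * (P.d * ((P.L : ℝ) ^ k * Sbox))) * (c₁ * (1 / (B2LargeField.lambdaEps lam ℓ P.d) ^ (1 / 4 : ℝ)) * B2.pFn b₀ p ℓ)) * P.d)
                  + Real.exp (-(1 / (4 * K₀) * ((R₁ : ℝ) + 1))) * (c₁ * (1 / (B2LargeField.lambdaEps lam ℓ P.d) ^ (1 / 4 : ℝ)) * B2.pFn b₀ p ℓ))
            + msq * P.mesh k ^ 2 / (B1.aSeq a P.L k + msq * P.mesh k ^ 2) * (c₁ * (1 / (B2LargeField.lambdaEps lam ℓ P.d) ^ (1 / 4 : ℝ)) * B2.pFn b₀ p ℓ)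
            + |C.e| * P.mesh 0 * (P.d * ((P.L : ℝ) ^ k - 1)) * (δA * (P.d * ((P.L : ℝ) ^ k * Sbox))) * (c₁ * (1 / (B2LargeField.lambdaEps lam ℓ P.d) ^ (1 / 4 : ℝ)) * B2.pFn b₀ p ℓ) := by
  obtain ⟨K₀min, h⟩ := eq265_higgs_region_restr255 d L hd hL ha hmsq N C ε₀ creg β hcreg hβ
  refine ⟨K₀min, fun K₀ hK₀ => ?_⟩
  obtain ⟨e₁, t, he₁, ht, C₁, C₂, C₃, D₁, D₂, D₃, D₄, hC₁, hC₂, hC₃, hD₁, hD₂, hD₃, hD₄, h⟩ := h K₀ hK₀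
  refine ⟨e₁, t, he₁, ht, C₁, C₂, C₃, D₁, D₂, D₃, D₄, hC₁, hC₂, hC₃, hD₁, hD₂, hD₃, hD₄, ?_⟩
  intro P hPd hPL hK₀M k hk1 hkK h3 hε h1 Λ₂ Λ₆ sq₂ sq₁ S q Sbox h62 hs2 h12 h16 hΩΛ hbox hSbox hsq₂ h2S q₁ R₁ hS₁ hsq₁ A δA hδA
    hgrad ht' ec hec hle hsmall x hx hcentre φ Λm1 A' c₁ b₀ p μ₀ lam ℓ hc₁ hb₀ hlam hℓ hℓ1 h6m1 h255
  -- the signs of the printed thresholds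
  have hlog : 0 ≤ 1 + Real.log ℓ⁻¹ := by
    have := Real.log_nonneg ((one_le_inv₀ hℓ).mpr hℓ1)
    linarith
  have hpℓ : 0 ≤ B2.pFn b₀ p ℓ := by
    unfold B2.pFn
    exact mul_nonneg hb₀ (Real.rpow_nonneg hlog p)
  have htPhi : 0 ≤ 1 / (B2LargeField.lambdaEps lam ℓ P.d) ^ (1 / 4 : ℝ) :=
    div_nonneg zero_le_one (Real.rpow_nonneg (B2LargeField.lambdaEps_pos hlam hℓ P.d).le _)
  have h255' : Restr255 C c₁ (B2.pFn b₀ p ℓ) (1 / (μ₀ * ℓ)) (1 / (B2LargeField.lambdaEps lam ℓ P.d) ^ (1 / 4 : ℝ)) k Λm1 A' φ A :=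
    h255
  exact h P hPd hPL hK₀M hk1 hkK h3 hε h1 Λ₂ Λ₆ sq₂ sq₁ S q Sbox h62 hs2 h12 h16 hΩΛ hbox hSbox hsq₂ h2S q₁ R₁ hS₁ hsq₁ A hδA hgrad
    ht' hec hle hsmall x hx hcentre φ Λm1 A' hc₁ hpℓ htPhi h6m1 h255'

end Eq265Restr

end Literature.MathematicalPhysics.QuantumFieldTheory.Balaban1983to89.B2Eq265Restrictions255

end
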